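import Literature.NumberTheory.DiophantineGeometry.StewartYuKappaDoorFiveHalves
import Literature.Barriers.ABC.BakerMethodBounds
import Literature.Barriers.ABC.BakerMethodBoundsEpsShape
import HarnessLib

/-!
# The Baker-method leaves `stewartTijdeman1986_upperBound`, `EpsShapeBoundFiveHalves`, `EpsShapeBoundThree` HOLD —
# by the kernel `p`-adic principal-core machine (re-homed cell library `abc-stewartyu`)

Topic `Literature/Barriers/ABC`.  This file only ASSEMBLES results proved in
`Literature/NumberTheory/Transcendental/StewartYuPadic{DescentSetup,W80Parameters,TheoremA}.lean` and
`Literature/NumberTheory/DiophantineGeometry/StewartYu{PrincipalUnitReduction,PrincipalUnitReductionSharp,KappaDoorFiveHalves}.lean` (the cell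
library `Summits/ABC/StewartYu/*` re-homed into `Literature/` by the Hodge foundations lane, prover p20, generation 39)
into the EXACT-name discharges of three named statements of the Baker-method catalogue (`BakerMethodBounds.lean`,
`BakerMethodBoundsEpsShape.lean`):

* **`stewartTijdeman1986_upperBound_holds`** — Stewart–Tijdeman 1986, Theorem 1 (upper bound), as quoted by Waldschmidt
  (2014) §2: there is an absolute `κ` with `log c ≤ κ · rad(abc)^{15}` for every abc-triple (`BakerShapeBound 15 0`).
  Proof (the route `PadicPrincipalCoreST86` of the ABC tree, verbatim its deciding composition `closes`): THEOREM A
  (`StewartYu.theoremAShape_holds`: the `p`-adic lower bound for linear forms in logarithms of rational principal units with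
  constant `C(m) ≤ c₁^m m^{c₂ m}`, `c₂ ≤ 10`) ∧ WP-M (`StewartYu.PrincipalLattice.exists_principal_generators`: reduction
  to Kummer-free principal generators) ⟹ by the glue `StewartYu.primePadicBoundAt_odd_of_principal` the one-prime bound
  `ord_p(∏ qᵢ^{eᵢ} − 1) ≤ 4704 (32c₁)ⁿ n^{(c₂+2)n} p² (∏ log qᵢ) L_B² L_Q²` at every ODD prime `p` ⟹ by the odd-prime
  socket `StewartYu.bakerShapeBound_of_oddPrime_logRadShape` the shape `BakerShapeBound (c₂ + 2 + 2 + 1) 0` ⟹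
  `BakerShapeBound 15 0` (`StewartYu.bakerShapeBound_zero_mono`, `c₂ + 5 ≤ 15`).
* **`EpsShapeBoundFiveHalves_holds`** — `log c ≪_ε rad(abc)^{5/2+ε}` (`StewartYu.epsShapeBound_five_halves`: Theorem A₁
  with `c₂ = 1`, the sharp reduction WP-M♭, the general glue and the κ-door of the Stewart–Yu 1991 line).
* **`EpsShapeBoundThree_holds`** — `log c ≪_ε rad(abc)^{3+ε}` (`epsShapeBoundThree_of_fiveHalves`).
* **`EpsShapeBoundFour_holds`** (ED. 2) — `log c ≪_ε rad(abc)^{4+ε}`, the EXACT-name discharge of `EpsShapeBoundFour := EpsShapeBound 4`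
  (`epsShapeBoundFour_of_three`; it had no Literature-side `_holds`).

Literature-side twins of `Summit.ABC.ABC.Theorems.stewartTijdeman1986_holds` (`StewartTijdeman1986Holds.lean`),
`Summit.ABC.StewartYu.epsShapeBoundFiveHalves_holds` (`PadicCW77EpsShapeFiveHalves.lean`) and
`Summit.ABC.ABC.Theorems.epsShapeBoundThree_holds` (`EpsShapeBoundThreeHolds.lean`) — same proofs; standard axioms; trust
base = the Lean kernel.  No new named fact (D-0026).

WHAT THIS IS NOT: exponential in `rad(abc)`, inside the Baker class — these are the technique's own bounds, not evasions of
the catalogued barrier `BakerMethodBounds`; far from Stewart–Yu 1991/2001 (`rad^{2/3+ε}`, `rad^{1/3+ε}`), whose inputs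
(Yu's theorem for algebraic numbers, `stewart_yu`) stay named facts; nothing about the abc conjecture itself.

## References

* C. L. Stewart, R. Tijdeman, *On the Oesterlé–Masser conjecture*, Monatsh. Math. 102 (1986) 251–257, Theorem 1 — as
  quoted in M. Waldschmidt, *Lecture on the abc conjecture and some of its consequences* (2014), §2. [StewartTijdeman1986]
  [Waldschmidt2014]
* C. L. Stewart, K. Yu, *On the abc conjecture*, Math. Ann. 291 (1991) 225–230, §3. [StewartYu1991]
* M. Waldschmidt, *A lower bound for linear forms in logarithms*, Acta Arith. 37 (1980) 257–283, Prop. 3.8. [Waldschmidt1980]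
-/

noncomputable section

namespace Literature.Barriers.ABC

open Literature.NumberTheory.Transcendental

/-- **Stewart–Tijdeman 1986, Theorem 1 (upper bound) HOLDS**: there is an absolute constant `κ` such that every abc triple
satisfies `log c ≤ κ · rad(abc)^{15}` — the EXACT discharge of the catalogue leaf `stewartTijdeman1986_upperBound`
(`= BakerShapeBound 15 0`), by the kernel `p`-adic principal-core machine at every odd prime: Theorem A
(`StewartYu.theoremAShape_holds`), the principal-generator reduction WP-M (`StewartYu.PrincipalLattice.exists_principal_generators`),
the glue (`StewartYu.primePadicBoundAt_odd_of_principal`, `K = 4704`, `L = 32c₁`, `κ = c₂ + 2`, `σ = τ = τ₁ = 2`) and the odd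
socket (`StewartYu.bakerShapeBound_of_oddPrime_logRadShape`, `StewartYu.bakerShapeBound_zero_mono` with `c₂ + 5 ≤ 15`).
Verbatim the deciding composition `closes` of route `PadicPrincipalCoreST86` of the ABC tree.
[cite: StewartTijdeman1986, Theorem 1 (upper bound), as quoted in Waldschmidt2014 §2] -/
theorem stewartTijdeman1986_upperBound_holds : stewartTijdeman1986_upperBound := by
  obtain ⟨C, r, c₁, c₂, hc₁, hc₂, hc₂10, hC, hA⟩ := StewartYu.theoremAShape_holds
  have h := fun (p : ℕ) (hp : p.Prime) (hp2 : p ≠ 2) (n : ℕ) (q : Fin n → ℕ) (e : Fin n → ℤ)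
      (hq : ∀ i, (q i).Prime) (hinj : Function.Injective q) (hqp : ∀ i, q i ≠ p) (he : e ≠ 0)
      (hne1 : ∏ i, ((q i : ℚ)) ^ e i ≠ 1) =>
    StewartYu.primePadicBoundAt_odd_of_principal StewartYu.PrincipalLattice.exists_principal_generators hc₁ hC hA
      hp hp2 n q e hq hinj hqp he hne1
  have hB : BakerShapeBound ((c₂ + 2) + 2 + 1) 0 :=
    StewartYu.bakerShapeBound_of_oddPrime_logRadShape (K := 4704) (L := 32 * c₁) (κ := c₂ + 2) (σ := 2) (τ := 2)
      (τ₁ := 2) (by norm_num) (by linarith) (by linarith) (by norm_num) h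
  exact StewartYu.bakerShapeBound_zero_mono (by linarith) hB

/-- **The rung leaf `EpsShapeBoundFiveHalves` HOLDS**: for every `ε > 0` there are `κ, c₀` with `log c ≤ κ · rad(abc)^{5/2+ε}`
for all abc-triples with `c ≥ c₀` — the EXACT discharge of the named statement `EpsShapeBoundFiveHalves := EpsShapeBound (5/2)`
of `BakerMethodBoundsEpsShape.lean`, by `StewartYu.epsShapeBound_five_halves` (Theorem A₁, WP-M♭, the general glue, the κ-door
of the Stewart–Yu line at the odd places). [cite: StewartYu1991, §3] [cite: Waldschmidt2014, §2] -/
theorem EpsShapeBoundFiveHalves_holds : EpsShapeBoundFiveHalves :=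
  StewartYu.epsShapeBoundFiveHalves_holds

/-- **The rung leaf `EpsShapeBoundThree` HOLDS**: for every `ε > 0` there are `κ, c₀` with `log c ≤ κ · rad(abc)^{3+ε}` for
all abc-triples with `c ≥ c₀` — the EXACT discharge of `EpsShapeBoundThree := EpsShapeBound 3`, from the rung `rad^{5/2+ε}`
(`epsShapeBoundThree_of_fiveHalves`). [cite: StewartYu1991, §3] [cite: Waldschmidt2014, §2] -/
theorem EpsShapeBoundThree_holds : EpsShapeBoundThree :=
  epsShapeBoundThree_of_fiveHalves EpsShapeBoundFiveHalves_holds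

/-- **The rung leaf `EpsShapeBoundFour` HOLDS** (ED. 2): for every `ε > 0` there are `κ, c₀` with `log c ≤ κ · rad(abc)^{4+ε}` for
all abc-triples with `c ≥ c₀` — the EXACT discharge of `EpsShapeBoundFour := EpsShapeBound 4`, from the rung `rad^{3+ε}`
(`epsShapeBoundFour_of_three`, monotonicity of the `ε`-shape in the exponent). [cite: StewartYu1991, §3] [cite: Waldschmidt2014, §2] -/
theorem EpsShapeBoundFour_holds : EpsShapeBoundFour :=
  epsShapeBoundFour_of_three EpsShapeBoundThree_holds

end Literature.Barriers.ABC
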